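import Mathlib
import HarnessLib
import Summits.NavierStokesRegularity.NavierStokesRegularity.Theorems.PoloidalWindowDoorLrcModEntireQ4CurvedVerticalEntrance
import Summits.NavierStokesRegularity.NavierStokesRegularity.Theorems.PoloidalWindowDoorLrcModEntireTwistingTHPlaneOscillation
import Summits.NavierStokesRegularity.NavierStokesRegularity.Theorems.PoloidalWindowDoorPoloidalWindowRigiditySlopeFunctionPressure
import Summits.NavierStokesRegularity.NavierStokesRegularity.Theorems.PoloidalWindowDoorPoloidalWindowRigidityTimeHeightShearLinearSlice
import Summits.NavierStokesRegularity.NavierStokesRegularity.Theorems.PoloidalWindowDoorPoloidalWindowRigidityConstantShearSlice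

/-!
# Route `PoloidalWindowDoor`, item `LrcModEntire` (stmt-NavierStokesRegularity-20428), cell (Q4-curved), v16 child «VERTICAL» —
# VERT-PROP (7a): THE CLOSED 1+1 RIDGE LAW ON THE CURTAIN, as a kernel identity at the hot time

Cell ns-regularity-ideate, helper seat ns-k2-port-2 g9 under the LEAD of item 20428 (ns-poloidal-K2-p3 g18, P4 2026-08-30T02:44:49Z: `Cruxes/LrcModEntire/VERT-PROP-g18.md`
v2/v3 §7 (7a)); `--supports stmt-NavierStokesRegularity-20428 --as helper`.  CLASS LEVEL at `t = −1`, on the (TH) slab `|z| < ρ`, at a curtain point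
`P = Γ s + z·e₂` of a vertical critical cylinder ((E1) of `…Q4CurvedVerticalEntrance.vertical_entrance`, verbatim; `Γ` any map into the plane `{y₂ = 0}`), in the
tree's PRESSURE-FREE currency: `f := ∂ₜU + (U·∇)U − ΔU` is the intrinsic residual (`= −∇p`; `timeDerivWithin (Iio 0) U t + convect (U t) (U t) − Δ (U t)`).

★★ `vertical_curtain_ridge_law` — three conjuncts at `P`:
* (i) THE MATERIAL LAW WITH VERTICAL ADVECTION ONLY: `∂ₜU₂(P) + U₂(P)·∂_zU₂(P) − ΔU₂(P) = f₂(P)` (`…SlopeFunctionPressure.material_vert_eq_residual` + (E1): the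
  horizontal advection `Uₕ·∇ₕU₂` drops);
* (ii) THE LAPLACIAN ON THE CURTAIN, division-free: `μ(−1,z)·ΔU₂(P) = (μ(−1,z) − 1)·∂_z²U₂(P)` (slice law `∂_z²U₂ = −μΔₕU₂` of the class, `plane_wave_identity`);
* (iii) THE PRESSURE TERM IS HEIGHT-ONLY: the doubled weight source `2(1−μ)f₂ − 2(μ_t − μ_zz)U₂ − μ_zU₂² + 4μ_z∂_zU₂` at `P` equals its value at the axis point
  `z·e₂` (`…TwistingTHPlaneOscillation.weightSource_eq_of_height_eq`, its `hslope` from the pointwise slab law on the open slab).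
Together (divide (i)×μ(1−μ) by μ ≠ 0): `(μ−1)[∂ₜU₂ + U₂∂_zU₂ − (1 − 1/μ)∂_z²U₂](P) = −(μ_tU₂ + (μ_z/2)U₂² − μ_zzU₂ − 2μ_z∂_zU₂ + 𝒜(z))`, every term a function on the
vertical line (by (E2)/(E3) of the V-ENTRANCE) — the V child's dynamics is visibly 1+1 (VERT-PROP §7 (7a)).

WHAT THIS IS NOT: not a claim about Navier–Stokes regularity; closes nothing (kernel brick for the RESEARCH slot `stub_Q4curvedAperiodicVertical`);
items 20428 / 19708 / 27893 OPEN (bears_on LADDER-NS N0).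
-/

noncomputable section

set_option linter.dupNamespace false
set_option linter.style.longLine false

namespace Summit.NavierStokesRegularity.NavierStokesRegularity.Theorems.PoloidalWindowDoorLrcModEntireQ4CurvedVerticalRidgeLaw

open Set Function Filter Topology Metric
open scoped RealInnerProductSpace InnerProductSpace Laplacian ContDiff
open Literature.Analysis Literature.Analysis.FluidPDE Literature.Analysis.UnboundedOperators
open Summit.NavierStokesRegularity.NavierStokesRegularity.Theorems
open Summit.NavierStokesRegularity.NavierStokesRegularity.Theorems.LocalSineTubeDoorProfileAlignedWindowRigidityAncient
open Summit.NavierStokesRegularity.NavierStokesRegularity.Theorems.PoloidalWindowDoorPoloidalWindowRigidityConstantShearSlice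
open Summit.NavierStokesRegularity.NavierStokesRegularity.Theorems.PoloidalWindowDoorPoloidalWindowRigidityTimeHeightShearLinearSlice
open Summit.NavierStokesRegularity.NavierStokesRegularity.Theorems.PoloidalWindowDoorPoloidalWindowRigiditySlopeFunctionPressure
open Summit.NavierStokesRegularity.NavierStokesRegularity.Theorems.PoloidalWindowDoorLrcModEntireTwistingTHPlaneOscillation
open Summit.NavierStokesRegularity.NavierStokesRegularity.Theorems.PoloidalWindowDoorLrcModEntireSheetFlattenTools

variable {C : ℝ} {U : ℝ → EuclideanSpace ℝ (Fin 3) → EuclideanSpace ℝ (Fin 3)}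

/-- ★★ **VERT-PROP (7a): THE CLOSED 1+1 RIDGE LAW ON THE CURTAIN** (material law with vertical advection only, the curtain Laplacian, and the height-only
pressure term) at a curtain point `Γ s + z·e₂`, `|z| < ρ`.  See the module docstring. -/
theorem vertical_curtain_ridge_law
    (hrate : HasTypeITimeDecay C U) (hcont : ContinuousOn (uncurry U) (Iio (0 : ℝ) ×ˢ univ))
    (hmild : ∀ s t : ℝ, s < t → t < 0 → ∀ x, U t x = heatExtension (U s) (t - s) x - oseenDuhamel 1 s U U t x)
    (hdiv : ∀ t < 0, VectorCalculus.IsDivFree (U t))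
    (hpol : ∀ s < 0, ∀ y, ⟪curl (U s) y, EuclideanSpace.single 2 1⟫_ℝ = 0)
    {μ : ℝ → ℝ → ℝ} (hμ3 : ContDiff ℝ 3 (uncurry μ)) {ρ : ℝ} (hρ : 0 < ρ)
    (hslabU : ∀ t : ℝ, |t + 1| < ρ → ∀ x : EuclideanSpace ℝ (Fin 3), |x 2| < ρ → ∀ b : Fin 3, b ≠ 2 →
      fderiv ℝ (U t) x (EuclideanSpace.single 2 1) b = μ t (x 2) * fderiv ℝ (U t) x (EuclideanSpace.single b 1) 2)
    {Γ : ℝ → EuclideanSpace ℝ (Fin 3)} (hΓ2 : ∀ s, Γ s 2 = 0)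
    (hE1 : ∀ s z : ℝ, ∀ w : EuclideanSpace ℝ (Fin 3), w 2 = 0 → fderiv ℝ (fun y => U (-1) y 2) (Γ s + z • e2) w = 0)
    (s : ℝ) {z : ℝ} (hz : |z| < ρ) :
    -- (i) material law with vertical advection only
    deriv (fun t => U t (Γ s + z • e2) 2) (-1) +
          U (-1) (Γ s + z • e2) 2 * fderiv ℝ (fun y => U (-1) y 2) (Γ s + z • e2) (EuclideanSpace.single 2 (1 : ℝ)) -
        Δ (fun y => U (-1) y 2) (Γ s + z • e2) =
      (timeDerivWithin (Iio 0) U (-1) (Γ s + z • e2) + convect (U (-1)) (U (-1)) (Γ s + z • e2) - Δ (U (-1)) (Γ s + z • e2)) 2 ∧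
    -- (ii) the Laplacian on the curtain (division-free slice law)
    μ (-1) z * Δ (fun y => U (-1) y 2) (Γ s + z • e2) =
      (μ (-1) z - 1) * fderiv ℝ (fun y => fderiv ℝ (fun y' => U (-1) y' 2) y (EuclideanSpace.single 2 (1 : ℝ))) (Γ s + z • e2) (EuclideanSpace.single 2 (1 : ℝ)) ∧
    -- (iii) the doubled weight source is height-only: its value at `P` is its value on the axis point `z·e₂`
    2 * (1 - μ (-1) z) * (timeDerivWithin (Iio 0) U (-1) (Γ s + z • e2) + convect (U (-1)) (U (-1)) (Γ s + z • e2) - Δ (U (-1)) (Γ s + z • e2)) 2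
        - 2 * (deriv (fun t => μ t z) (-1) - deriv (deriv (μ (-1))) z) * U (-1) (Γ s + z • e2) 2
        - deriv (μ (-1)) z * U (-1) (Γ s + z • e2) 2 ^ 2
        + 4 * deriv (μ (-1)) z * fderiv ℝ (U (-1)) (Γ s + z • e2) (EuclideanSpace.single 2 1) 2 =
      2 * (1 - μ (-1) z) * (timeDerivWithin (Iio 0) U (-1) (z • e2) + convect (U (-1)) (U (-1)) (z • e2) - Δ (U (-1)) (z • e2)) 2
        - 2 * (deriv (fun t => μ t z) (-1) - deriv (deriv (μ (-1))) z) * U (-1) (z • e2) 2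
        - deriv (μ (-1)) z * U (-1) (z • e2) 2 ^ 2
        + 4 * deriv (μ (-1)) z * fderiv ℝ (U (-1)) (z • e2) (EuclideanSpace.single 2 1) 2 := by
  have hm1 : (-1 : ℝ) < 0 := by norm_num
  have hm1ρ : |(-1 : ℝ) + 1| < ρ := by norm_num; exact hρ
  have hP2 : (Γ s + z • e2) 2 = z := by simp [hΓ2 s, e2]
  have hA2 : (z • e2 : EuclideanSpace ℝ (Fin 3)) 2 = z := by simp [e2]
  -- smoothness of the slice
  have hUan : AnalyticOnNhd ℝ (U (-1)) univ := analyticOnNhd_slice hcont (bdd_of_hasTypeITimeDecay hrate) hmild hm1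
  have hU2 : ContDiff ℝ 2 (U (-1)) := hUan.contDiff
  have hθan : AnalyticOnNhd ℝ (fun y => U (-1) y 2) univ := fun x _ =>
    ((EuclideanSpace.proj (𝕜 := ℝ) (2 : Fin 3)).analyticAt _).comp (hUan x (mem_univ _))
  have hθ2 : ContDiff ℝ 2 (fun y => U (-1) y 2) := hθan.contDiff
  refine ⟨?_, ?_, ?_⟩
  · /- (i): the vertical momentum equation in coordinates, with the horizontal advection killed by (E1) -/
    have hmat := material_vert_eq_residual hrate hcont hmild hdiv hm1 (Γ s + z • e2)
    have hsplit : U (-1) (Γ s + z • e2) =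
        (U (-1) (Γ s + z • e2) - U (-1) (Γ s + z • e2) 2 • (EuclideanSpace.single 2 (1 : ℝ) : EuclideanSpace ℝ (Fin 3))) +
          U (-1) (Γ s + z • e2) 2 • (EuclideanSpace.single 2 (1 : ℝ) : EuclideanSpace ℝ (Fin 3)) := by
      rw [sub_add_cancel]
    have hhor : (U (-1) (Γ s + z • e2) - U (-1) (Γ s + z • e2) 2 • (EuclideanSpace.single 2 (1 : ℝ) : EuclideanSpace ℝ (Fin 3))) 2 = 0 := by
      simp
    have hadv : fderiv ℝ (fun y => U (-1) y 2) (Γ s + z • e2) (U (-1) (Γ s + z • e2)) =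
        U (-1) (Γ s + z • e2) 2 * fderiv ℝ (fun y => U (-1) y 2) (Γ s + z • e2) (EuclideanSpace.single 2 (1 : ℝ)) := by
      calc fderiv ℝ (fun y => U (-1) y 2) (Γ s + z • e2) (U (-1) (Γ s + z • e2))
          = fderiv ℝ (fun y => U (-1) y 2) (Γ s + z • e2)
              ((U (-1) (Γ s + z • e2) - U (-1) (Γ s + z • e2) 2 • (EuclideanSpace.single 2 (1 : ℝ) : EuclideanSpace ℝ (Fin 3))) +
                U (-1) (Γ s + z • e2) 2 • (EuclideanSpace.single 2 (1 : ℝ) : EuclideanSpace ℝ (Fin 3))) := by rw [← hsplit]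
        _ = U (-1) (Γ s + z • e2) 2 * fderiv ℝ (fun y => U (-1) y 2) (Γ s + z • e2) (EuclideanSpace.single 2 (1 : ℝ)) := by
          rw [map_add, map_smul, hE1 s z _ hhor, zero_add, smul_eq_mul]
    rw [hadv] at hmat
    exact hmat
  · /- (ii): `Δ = ∂₀² + ∂₁² + ∂₂²` and the slice law `∂₂² = −μ(∂₀² + ∂₁²)` at the curtain point -/
    have hΔ := laplacian_eq_sum_fderiv_fderiv hθ2 (Γ s + z • e2)
    rw [Fin.sum_univ_three] at hΔ
    have hplane : ∀ y : EuclideanSpace ℝ (Fin 3), y 2 = z → ∀ b : Fin 3, b ≠ 2 →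
        fderiv ℝ (U (-1)) y (EuclideanSpace.single 2 (1 : ℝ)) b = μ (-1) z * fderiv ℝ (U (-1)) y (EuclideanSpace.single b (1 : ℝ)) 2 := by
      intro y hy b hb
      have h := hslabU (-1) hm1ρ y (by rw [hy]; exact hz) b hb; rw [hy] at h; exact h
    have hlaw := plane_wave_identity hU2 (fun y => div_coord (hdiv _ hm1) y) hplane hP2
    rw [hΔ]
    linear_combination hlaw
  · /- (iii): the doubled weight source is horizontally constant (TH); its `hslope` from the pointwise slab law on the open slab -/
    have hxx' : (Γ s + z • e2) 2 = (z • e2 : EuclideanSpace ℝ (Fin 3)) 2 := by rw [hP2, hA2]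
    have hSo : IsOpen {q : ℝ × EuclideanSpace ℝ (Fin 3) | |q.1 + 1| < ρ ∧ |q.2 2| < ρ} :=
      (isOpen_lt (continuous_fst.add continuous_const).abs continuous_const).inter
        (isOpen_lt (((EuclideanSpace.proj (𝕜 := ℝ) (2 : Fin 3)).continuous.comp continuous_snd).abs) continuous_const)
    have hslope : ∀ y : EuclideanSpace ℝ (Fin 3), y 2 = (Γ s + z • e2) 2 →
        ∀ᶠ q in 𝓝 (((-1 : ℝ), y) : ℝ × EuclideanSpace ℝ (Fin 3)), ∀ b : Fin 3, b ≠ 2 →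
          fderiv ℝ (U q.1) q.2 (EuclideanSpace.single 2 1) b = μ q.1 (q.2 2) * fderiv ℝ (U q.1) q.2 (EuclideanSpace.single b 1) 2 := by
      intro y hy
      have hmem : (((-1 : ℝ), y) : ℝ × EuclideanSpace ℝ (Fin 3)) ∈ {q : ℝ × EuclideanSpace ℝ (Fin 3) | |q.1 + 1| < ρ ∧ |q.2 2| < ρ} := by
        refine ⟨hm1ρ, ?_⟩
        show |y 2| < ρ
        rw [hy, hP2]; exact hz
      filter_upwards [hSo.mem_nhds hmem] with q hq
      exact fun b hb => hslabU q.1 hq.1 q.2 hq.2 b hb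
    have h := weightSource_eq_of_height_eq hrate hcont hmild hdiv hpol hμ3 hm1 hxx' hslope
    rw [hP2, hA2] at h
    exact h

end Summit.NavierStokesRegularity.NavierStokesRegularity.Theorems.PoloidalWindowDoorLrcModEntireQ4CurvedVerticalRidgeLaw

end
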